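import Mathlib
import HarnessLib
import Summits.KontsevichZagierPeriods.KontsevichZagierPeriods.Theses.LinRedNormalForm
import Summits.KontsevichZagierPeriods.KontsevichZagierPeriods.Theorems.LinRedNormalFormDihedralNormalFormStubAtomReduction
import Summits.KontsevichZagierPeriods.KontsevichZagierPeriods.Theorems.LinRedNormalFormDihedralNormalFormDimLeThree
import Summits.KontsevichZagierPeriods.KontsevichZagierPeriods.Theorems.LinRedNormalFormDihedralNormalFormStubProductClosure
import Summits.KontsevichZagierPeriods.KontsevichZagierPeriods.Theorems.LinRedNormalFormDihedralNormalFormStubChartBack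
import Summits.KontsevichZagierPeriods.KontsevichZagierPeriods.Theorems.LinRedNormalFormDihedralNormalFormStubSimplexProductSplit
import Summits.KontsevichZagierPeriods.KontsevichZagierPeriods.Theorems.LinRedNormalFormDihedralNormalFormStubDilationNL
import Summits.KontsevichZagierPeriods.KontsevichZagierPeriods.Theorems.LinRedNormalFormDihedralNormalFormOfUnnestingNonProduct

/-!
# `DihedralNormalForm` from the simplicial residual (line `torus-descent-sum-shadow`, v7 closing)

The conditional closing theorem `dihedralNormalForm_of_simplicialResidual` of skeleton v7 of the
line `torus-descent-sum-shadow` for the crux `DihedralNormalForm` (stmt-KontsevichZagierPeriods-3912,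
route `LinRedNormalForm`).  With every analytic move schema of the line landed (the cubical chain of
dimension `≤ 3`, `…DimLeThree`; the chart back to the simplex, `stub_chartBack`; the product split on
the simplex, `stub_simplexProductSplit`; products of normal forms, `stub_productClosure`; the dilation
move, `stub_dilationNL`), the crux is REDUCED to two statements about convergent SIMPLICIAL LAURENT
MONOMIAL representations `[Δ_k, q·∏ tᵢ^{βᵢ}(1-tᵢ)^{γᵢ}∏_{i<j}(tᵢ-tⱼ)^{αᵢⱼ}]` of dimension `k ≥ 4`
(`Δ_k` the open ordered simplex `1 > t₀ > ⋯ > t_{k-1} > 0`, exponents in `ℤ`, absolute convergence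
carried by the representation):
* `DERHAM_HIGH` — EFFECTIVE CONVERGENT DE RHAM REDUCTION "(F)": every such representation is congruent
  modulo `KZ.relations` to a `ℤ`-combination of LOG-WINDOW representations (all exponents `0/−1`,
  exactly `k` poles), simplicial PRODUCT monomials of dimension `k` (a seam `0 < p < k` not crossed by
  any letter) and convergent simplicial monomials of dimension `< k`;
* `LOGCORE_HIGH` — THE LOG CORE "(C)": every log-window representation of dimension `k ≥ 4` is
  congruent modulo `KZ.relations` to a `ℤ`-combination of MZV word representations, simplicial
  product monomials of dimension `k` and convergent simplicial monomials of dimension `< k`.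
Taking both (verbatim) as hypotheses, `LinRedNormalForm.DihedralNormalForm` holds BY NAME.  The
registered stubs `stub_deRham`, `stub_logCore` of the line are `D → DERHAM_HIGH`, `D → LOGCORE_HIGH`
with `D` the (landed) statement of `stub_dilationNL`; the corollary
`dihedralNormalForm_of_registeredStubs` records that shape too.

Mathematically, for `n = k + 3`: the log window spans `H^{n-3}` of Brown's partial compactification
`M^δ_{0,n}` (the convergent global logarithmic forms; dimensions `1, 4, 22, 144` for `n = 5, …, 8`),
`DERHAM_HIGH` is the statement that Kontsevich–Zagier moves realise the reduction of every regular
algebraic top form on the affine variety `M^δ_{0,n}` to that window, and `LOGCORE_HIGH` is the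
move-level form of Brown's theorem (the periods of `M^δ_{0,n}` are multiple zeta values) on the window.

Proof: ENTRANCE `stub_atomReduction` (the input is a combination of convergent cubical atoms); every
atom is a convergent simplicial monomial (`stub_chartBack`); strong induction on the dimension
(`OfSimplicialResidual.smono_red`): `k ≤ 3` through the genus-zero rewriting `smono_eq_gz`,
`stub_atomReduction` and the landed chain `DimLeThree.atom_red_le_three`; `k ≥ 4` through
`DERHAM_HIGH`, then `LOGCORE_HIGH` on the window, `stub_simplexProductSplit` + `stub_productClosure`
on products, and the induction hypothesis below `k`; the generator-wise congruences extend additively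
(`DimLeThree.closure_transfer`).  No definitions are introduced: the generator families, the
reduction relation and the two hypotheses are parse-time notations.

References: M. Kontsevich, D. Zagier, *Periods* (2001), §1.2; F. Brown, *Multiple zeta values and
periods of moduli spaces* `M_{0,n}`, Ann. Sci. ÉNS 42 (2009), Thm 1.1, §2 (affineness of `M^δ`);
C. Dupont, B. Vallette, *Brown's moduli spaces of curves and the gravity operad*, Geom. Topol. 21
(2017), Thm 3.11 (purity: `H^k(M^δ_{0,n})` is the kernel of the residues along the chords of `δ`).
-/

noncomputable section

open MeasureTheory Set

namespace Summit.KontsevichZagierPeriods.DihedralNormalForm.TorusDescent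

open Literature.NumberTheory.Transcendental
open Summit.KontsevichZagierPeriods.DihedralNormalForm.TameBVStokes (stub_productClosure)

namespace OfSimplicialResidual

open DimLeThree

/-! ### Notation (parse-time abbreviations; no definitions are introduced) -/

set_option quotPrecheck false

/-- The crux's target generators: MZV word representations `[Δ_w, q · ∏ ω_{εᵢ}(tᵢ)]`. -/
local notation "WORDS" =>
  ({x : Literature.NumberTheory.Transcendental.KZ.FormalRep | ∃ (w : ℕ) (ε : Fin w → Bool) (q : ℚ) (s : Literature.NumberTheory.Transcendental.KZ.IntegralRep w), s.domain = {t | (∀ i, 0 < t i) ∧ (∀ i, t i < 1) ∧ StrictAnti t} ∧ Set.EqOn s.integrand (fun t => (q : ℝ) * ∏ i, if ε i then 1 / (1 - t i) else 1 / t i) s.domain ∧ x = Literature.NumberTheory.Transcendental.KZ.of s} : Set KZ.FormalRep)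
/-- Convergent cubical atoms of dimension `k`. -/
local notation "ATOMS⟪" k "⟫" =>
  ({z : Literature.NumberTheory.Transcendental.KZ.FormalRep | ∃ (q : ℚ) (a : Fin k → ℕ) (e : Fin k → Fin k → ℤ) (s : Literature.NumberTheory.Transcendental.KZ.IntegralRep k), s.domain = {x : Fin k → ℝ | ∀ i, x i ∈ Set.Ioo (0:ℝ) 1} ∧ Set.EqOn s.integrand (fun x => (q : ℝ) * ((∏ i : Fin k, x i ^ a i) * ∏ i : Fin k, ∏ j : Fin k, if i ≤ j then (1 - (∏ l : Fin k, if i ≤ l ∧ l ≤ j then x l else 1)) ^ e i j else 1)) s.domain ∧ z = Literature.NumberTheory.Transcendental.KZ.of s} : Set KZ.FormalRep)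
/-- Convergent simplicial Laurent monomial representations of dimension `k`. -/
local notation "SMONO⟪" k "⟫" =>
  ({z : Literature.NumberTheory.Transcendental.KZ.FormalRep | ∃ (q : ℚ) (β γ : Fin k → ℤ) (α : Fin k → Fin k → ℤ) (s : Literature.NumberTheory.Transcendental.KZ.IntegralRep k), s.domain = {t : Fin k → ℝ | (∀ i, 0 < t i) ∧ (∀ i, t i < 1) ∧ StrictAnti t} ∧ Set.EqOn s.integrand (fun t => (q : ℝ) * ((∏ i : Fin k, t i ^ β i) * (∏ i : Fin k, (1 - t i) ^ γ i) * ∏ i : Fin k, ∏ j : Fin k, if i < j then (t i - t j) ^ α i j else 1)) s.domain ∧ z = Literature.NumberTheory.Transcendental.KZ.of s} : Set KZ.FormalRep)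
/-- Convergent simplicial monomials of dimension `< k`. -/
local notation "SMONOLT⟪" k "⟫" =>
  ({z : Literature.NumberTheory.Transcendental.KZ.FormalRep | ∃ d : ℕ, d < k ∧ z ∈ {z : Literature.NumberTheory.Transcendental.KZ.FormalRep | ∃ (q : ℚ) (β γ : Fin d → ℤ) (α : Fin d → Fin d → ℤ) (s : Literature.NumberTheory.Transcendental.KZ.IntegralRep d), s.domain = {t : Fin d → ℝ | (∀ i, 0 < t i) ∧ (∀ i, t i < 1) ∧ StrictAnti t} ∧ Set.EqOn s.integrand (fun t => (q : ℝ) * ((∏ i : Fin d, t i ^ β i) * (∏ i : Fin d, (1 - t i) ^ γ i) * ∏ i : Fin d, ∏ j : Fin d, if i < j then (t i - t j) ^ α i j else 1)) s.domain ∧ z = Literature.NumberTheory.Transcendental.KZ.of s}} : Set KZ.FormalRep)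
/-- Simplicial product monomials of dimension `k` (a seam `0 < p < k`). -/
local notation "SPROD⟪" k "⟫" =>
  ({z : Literature.NumberTheory.Transcendental.KZ.FormalRep | ∃ (q : ℚ) (β γ : Fin k → ℤ) (α : Fin k → Fin k → ℤ) (s : Literature.NumberTheory.Transcendental.KZ.IntegralRep k), (∃ p : ℕ, 0 < p ∧ p < k ∧ (∀ i : Fin k, p ≤ (i : ℕ) → γ i = 0) ∧ (∀ i j : Fin k, (i : ℕ) + 1 < p → p ≤ (j : ℕ) → α i j = 0)) ∧ s.domain = {t : Fin k → ℝ | (∀ i, 0 < t i) ∧ (∀ i, t i < 1) ∧ StrictAnti t} ∧ Set.EqOn s.integrand (fun t => (q : ℝ) * ((∏ i : Fin k, t i ^ β i) * (∏ i : Fin k, (1 - t i) ^ γ i) * ∏ i : Fin k, ∏ j : Fin k, if i < j then (t i - t j) ^ α i j else 1)) s.domain ∧ z = Literature.NumberTheory.Transcendental.KZ.of s} : Set KZ.FormalRep)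
/-- The log window of dimension `k`: exponents `0/−1`, exactly `k` poles. -/
local notation "SLOG⟪" k "⟫" =>
  ({z : Literature.NumberTheory.Transcendental.KZ.FormalRep | ∃ (q : ℚ) (β γ : Fin k → ℤ) (α : Fin k → Fin k → ℤ) (s : Literature.NumberTheory.Transcendental.KZ.IntegralRep k), ((∀ i : Fin k, β i = 0 ∨ β i = -1) ∧ (∀ i : Fin k, γ i = 0 ∨ γ i = -1) ∧ (∀ i j : Fin k, α i j = 0 ∨ α i j = -1) ∧ (∑ i : Fin k, β i) + (∑ i : Fin k, γ i) + (∑ i : Fin k, ∑ j : Fin k, if i < j then α i j else 0) = -(k : ℤ)) ∧ s.domain = {t : Fin k → ℝ | (∀ i, 0 < t i) ∧ (∀ i, t i < 1) ∧ StrictAnti t} ∧ Set.EqOn s.integrand (fun t => (q : ℝ) * ((∏ i : Fin k, t i ^ β i) * (∏ i : Fin k, (1 - t i) ^ γ i) * ∏ i : Fin k, ∏ j : Fin k, if i < j then (t i - t j) ^ α i j else 1)) s.domain ∧ z = Literature.NumberTheory.Transcendental.KZ.of s} : Set KZ.FormalRep)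
/-- Generator-wise reduction modulo `KZ.relations` of the family `S` onto the family `T`. -/
local notation "RED⟪" S ", " T "⟫" =>
  (∀ x ∈ (S : Set KZ.FormalRep), ∃ c ∈ AddSubgroup.closure (T : Set KZ.FormalRep), x - c ∈ KZ.relations)
/-- `DERHAM_HIGH`: effective convergent de Rham reduction of simplicial monomials of dimension `≥ 4`. -/
local notation "DERHAM_HIGH" =>
  (∀ (k : ℕ) (q : ℚ) (β γ : Fin k → ℤ) (α : Fin k → Fin k → ℤ) (s : Literature.NumberTheory.Transcendental.KZ.IntegralRep k), 4 ≤ k → s.domain = {t : Fin k → ℝ | (∀ i, 0 < t i) ∧ (∀ i, t i < 1) ∧ StrictAnti t} → Set.EqOn s.integrand (fun t => (q : ℝ) * ((∏ i : Fin k, t i ^ β i) * (∏ i : Fin k, (1 - t i) ^ γ i) * ∏ i : Fin k, ∏ j : Fin k, if i < j then (t i - t j) ^ α i j else 1)) s.domain → ∃ m ∈ AddSubgroup.closure ({z : Literature.NumberTheory.Transcendental.KZ.FormalRep | ∃ (q : ℚ) (β γ : Fin k → ℤ) (α : Fin k → Fin k → ℤ) (s : Literature.NumberTheory.Transcendental.KZ.IntegralRep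 k), ((∀ i : Fin k, β i = 0 ∨ β i = -1) ∧ (∀ i : Fin k, γ i = 0 ∨ γ i = -1) ∧ (∀ i j : Fin k, α i j = 0 ∨ α i j = -1) ∧ (∑ i : Fin k, β i) + (∑ i : Fin k, γ i) + (∑ i : Fin k, ∑ j : Fin k, if i < j then α i j else 0) = -(k : ℤ)) ∧ s.domain = {t : Fin k → ℝ | (∀ i, 0 < t i) ∧ (∀ i, t i < 1) ∧ StrictAnti t} ∧ Set.EqOn s.integrand (fun t => (q : ℝ) * ((∏ i : Fin k, t i ^ β i) * (∏ i : Fin k, (1 - t i) ^ γ i) * ∏ i : Fin k, ∏ j : Fin k, if i < j then (t i - t j) ^ α i j else 1)) s.domain ∧ z = Literature.NumberTheory.Transcendental.KZ.of s} ∪ {z : Literature.NumberTheory.Transcendental.KZ.FormalRep | ∃ (q : ℚ) (β γ : Fin k → ℤ) (α : Fin k → Fin k → ℤ) (s : Literature.NumberTheory.Transcendental.KZ.IntegralRep k), (∃ p : ℕ, 0 < p ∧ p < k ∧ (∀ i : Fin k, p ≤ (i : ℕ) → γ i = 0) ∧ (∀ i j : Fin k, (i : ℕ) + 1 < p → p ≤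 (j : ℕ) → α i j = 0)) ∧ s.domain = {t : Fin k → ℝ | (∀ i, 0 < t i) ∧ (∀ i, t i < 1) ∧ StrictAnti t} ∧ Set.EqOn s.integrand (fun t => (q : ℝ) * ((∏ i : Fin k, t i ^ β i) * (∏ i : Fin k, (1 - t i) ^ γ i) * ∏ i : Fin k, ∏ j : Fin k, if i < j then (t i - t j) ^ α i j else 1)) s.domain ∧ z = Literature.NumberTheory.Transcendental.KZ.of s} ∪ {z : Literature.NumberTheory.Transcendental.KZ.FormalRep | ∃ d : ℕ, d < k ∧ z ∈ {z : Literature.NumberTheory.Transcendental.KZ.FormalRep | ∃ (q : ℚ) (β γ : Fin d → ℤ) (α : Fin d → Fin d → ℤ) (s : Literature.NumberTheory.Transcendental.KZ.IntegralRep d), s.domain = {t : Fin d → ℝ | (∀ i, 0 < t i) ∧ (∀ i, t i < 1) ∧ StrictAnti t} ∧ Set.EqOn s.integrand (fun t => (q : ℝ) * ((∏ i : Fin d, t i ^ β i) * (∏ i : Fin d, (1 - t i) ^ γ i) * ∏ i : Fin d, ∏ j : Fin d, if i < j then (t i - t j) ^ α i j else 1)) s.domain ∧ z = Literature.NumberTheory.Transcendental.KZ.of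 s}}), Literature.NumberTheory.Transcendental.KZ.of s - m ∈ Literature.NumberTheory.Transcendental.KZ.relations : Prop)
/-- `LOGCORE_HIGH`: the log window of dimension `≥ 4` reduces to words, products and lower dimension. -/
local notation "LOGCORE_HIGH" =>
  (∀ (k : ℕ) (q : ℚ) (β γ : Fin k → ℤ) (α : Fin k → Fin k → ℤ) (s : Literature.NumberTheory.Transcendental.KZ.IntegralRep k), 4 ≤ k → (∀ i : Fin k, β i = 0 ∨ β i = -1) → (∀ i : Fin k, γ i = 0 ∨ γ i = -1) → (∀ i j : Fin k, α i j = 0 ∨ α i j = -1) → (∑ i : Fin k, β i) + (∑ i : Fin k, γ i) + (∑ i : Fin k, ∑ j : Fin k, if i < j then α i j else 0) = -(k : ℤ) → s.domain = {t : Fin k → ℝ | (∀ i, 0 < t i) ∧ (∀ i, t i < 1) ∧ StrictAnti t} → Set.EqOn s.integrand (fun t => (q : ℝ) * ((∏ i : Fin k, t i ^ β i) * (∏ i : Fin k, (1 - t i) ^ γ i) * ∏ i : Fin k, ∏ j : Fin k, if i < j then (t i - t j) ^ α i j else 1)) s.domain → ∃ m ∈ AddSubgroup.closure ({x : Literature.NumberTheory.Transcendental.KZ.FormalRep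 | ∃ (w : ℕ) (ε : Fin w → Bool) (q : ℚ) (s : Literature.NumberTheory.Transcendental.KZ.IntegralRep w), s.domain = {t | (∀ i, 0 < t i) ∧ (∀ i, t i < 1) ∧ StrictAnti t} ∧ Set.EqOn s.integrand (fun t => (q : ℝ) * ∏ i, if ε i then 1 / (1 - t i) else 1 / t i) s.domain ∧ x = Literature.NumberTheory.Transcendental.KZ.of s} ∪ {z : Literature.NumberTheory.Transcendental.KZ.FormalRep | ∃ (q : ℚ) (β γ : Fin k → ℤ) (α : Fin k → Fin k → ℤ) (s : Literature.NumberTheory.Transcendental.KZ.IntegralRep k), (∃ p : ℕ, 0 < p ∧ p < k ∧ (∀ i : Fin k, p ≤ (i : ℕ) → γ i = 0) ∧ (∀ i j : Fin k, (i : ℕ) + 1 < p → p ≤ (j : ℕ) → α i j = 0)) ∧ s.domain = {t : Fin k → ℝ | (∀ i, 0 < t i) ∧ (∀ i, t i < 1) ∧ StrictAnti t} ∧ Set.EqOn s.integrand (fun t => (q : ℝ) * ((∏ i : Fin k, t i ^ β i) * (∏ i : Fin k, (1 - t i) ^ γ i) * ∏ i : Fin k, ∏ j : Fin k, if i < j then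 (t i - t j) ^ α i j else 1)) s.domain ∧ z = Literature.NumberTheory.Transcendental.KZ.of s} ∪ {z : Literature.NumberTheory.Transcendental.KZ.FormalRep | ∃ d : ℕ, d < k ∧ z ∈ {z : Literature.NumberTheory.Transcendental.KZ.FormalRep | ∃ (q : ℚ) (β γ : Fin d → ℤ) (α : Fin d → Fin d → ℤ) (s : Literature.NumberTheory.Transcendental.KZ.IntegralRep d), s.domain = {t : Fin d → ℝ | (∀ i, 0 < t i) ∧ (∀ i, t i < 1) ∧ StrictAnti t} ∧ Set.EqOn s.integrand (fun t => (q : ℝ) * ((∏ i : Fin d, t i ^ β i) * (∏ i : Fin d, (1 - t i) ^ γ i) * ∏ i : Fin d, ∏ j : Fin d, if i < j then (t i - t j) ^ α i j else 1)) s.domain ∧ z = Literature.NumberTheory.Transcendental.KZ.of s}}), Literature.NumberTheory.Transcendental.KZ.of s - m ∈ Literature.NumberTheory.Transcendental.KZ.relations : Prop)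
/-- `DILATION_NL`: the statement of the landed dilation move `stub_dilationNL` (the antecedent of the
registered stubs). -/
local notation "DILATION_NL" =>
  (∀ (k : ℕ) (m : Fin (k + 1)) (q : ℚ) (β γ : Fin (k + 1) → ℤ) (α : Fin (k + 1) → Fin (k + 1) → ℤ) (R : Literature.NumberTheory.Transcendental.KZ.IntegralRep (k + 1)) (rb : Literature.NumberTheory.Transcendental.KZ.IntegralRep k), R.domain = {t : Fin (k + 1) → ℝ | (∀ i, 0 < t i) ∧ (∀ i, t i < 1) ∧ StrictAnti t} → Set.EqOn R.integrand (fun t => ((q : ℝ) * ((∏ i : Fin (k + 1), t i ^ β i) * (∏ i : Fin (k + 1), (1 - t i) ^ γ i) * ∏ i : Fin (k + 1), ∏ j : Fin (k + 1), if i < j then (t i - t j) ^ α i j else 1)) * ((((k : ℝ) + 1 - (m : ℝ)) + (∑ j : Fin (k + 1), if m ≤ j then (β j : ℝ) else 0) + (∑ i : Fin (k + 1), ∑ j : Fin (k + 1), if m ≤ i ∧ i < j then (α i j : ℝ) else 0)) + (∑ i : Fin (k + 1), ∑ j : Fin (k + 1), if i < m ∧ m ≤ j then (α i j : ℝ) *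 (-t j) / (t i - t j) else 0) + (∑ j : Fin (k + 1), if m ≤ j then (γ j : ℝ) * (-t j) / (1 - t j) else 0))) R.domain → rb.domain = {t : Fin k → ℝ | (∀ i, 0 < t i) ∧ (∀ i, t i < 1) ∧ StrictAnti t} → Set.EqOn rb.integrand (fun y => (if h : 0 < (m : ℕ) then y ⟨(m : ℕ) - 1, by omega⟩ else 1) * ((q : ℝ) * ((∏ i : Fin (k + 1), (Fin.insertNth m (if h : 0 < (m : ℕ) then y ⟨(m : ℕ) - 1, by omega⟩ else 1) y : Fin (k + 1) → ℝ) i ^ β i) * (∏ i : Fin (k + 1), (1 - (Fin.insertNth m (if h : 0 < (m : ℕ) then y ⟨(m : ℕ) - 1, by omega⟩ else 1) y : Fin (k + 1) → ℝ) i) ^ γ i) * ∏ i : Fin (k + 1), ∏ j : Fin (k + 1), if i < j then ((Fin.insertNth m (if h : 0 < (m : ℕ) then y ⟨(m : ℕ) - 1, by omega⟩ else 1) y : Fin (k + 1) → ℝ) i - (Fin.insertNth m (if h : 0 < (m : ℕ) then y ⟨(m : ℕ) - 1, by omega⟩ else 1) y : Fin (k + 1) → ℝ) j) ^ α i j else 1)))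 rb.domain → (if h : 0 < (m : ℕ) then 0 ≤ α ⟨(m : ℕ) - 1, by omega⟩ m else 0 ≤ γ m) → 0 < ((k : ℤ) + 1 - (m : ℤ)) + (∑ j : Fin (k + 1), if m ≤ j then β j else 0) + (∑ i : Fin (k + 1), ∑ j : Fin (k + 1), if m ≤ i ∧ i < j then α i j else 0) → Literature.NumberTheory.Transcendental.KZ.of R - Literature.NumberTheory.Transcendental.KZ.of rb ∈ Literature.NumberTheory.Transcendental.KZ.relations : Prop)

set_option quotPrecheck true

/-! ### Simplicial monomials are genus-zero inputs of `stub_atomReduction` -/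

/-- On the open ordered simplex a simplicial Laurent monomial is a genus-zero integrand with a
monomial numerator: `q·∏ tᵢ^{βᵢ}(1-tᵢ)^{γᵢ}∏(tᵢ-tⱼ)^{αᵢⱼ} = P(t) / (∏ tᵢ^{bᵢ} ∏ (1-tᵢ)^{cᵢ} ∏ (tᵢ-tⱼ)^{aᵢⱼ})`
with `b = β⁻`, `c = γ⁻`, `a = α⁻` and `P = q·∏ Xᵢ^{β⁺ᵢ}(1-Xᵢ)^{γ⁺ᵢ}∏(Xᵢ-Xⱼ)^{α⁺ᵢⱼ}`. [folklore] -/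
theorem smono_eq_gz {k : ℕ} (q : ℚ) (β γ : Fin k → ℤ) (α : Fin k → Fin k → ℤ)
    (t : Fin k → ℝ) (ht : t ∈ {t : Fin k → ℝ | (∀ i, 0 < t i) ∧ (∀ i, t i < 1) ∧ StrictAnti t}) :
    (q : ℝ) * ((∏ i : Fin k, t i ^ β i) * (∏ i : Fin k, (1 - t i) ^ γ i) * ∏ i : Fin k, ∏ j : Fin k, if i < j then (t i - t j) ^ α i j else 1)
      = MvPolynomial.aeval t (MvPolynomial.C q * ((∏ i : Fin k, MvPolynomial.X i ^ (β i).toNat) * (∏ i : Fin k, (1 - MvPolynomial.X i) ^ (γ i).toNat) * ∏ i : Fin k, ∏ j : Fin k, if i < j then (MvPolynomial.X i - MvPolynomial.X j) ^ (α i j).toNat else 1) : MvPolynomial (Fin k) ℚ)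
        / ((∏ i, t i ^ (fun i => (-β i).toNat) i) * (∏ i, (1 - t i) ^ (fun i => (-γ i).toNat) i) * ∏ i, ∏ j, if i < j then (t i - t j) ^ (fun i j => (-α i j).toNat) i j else 1) := by
  obtain ⟨h0, h1, hanti⟩ := ht
  have ht0 : ∀ i, t i ≠ 0 := fun i => (h0 i).ne'
  have ht1 : ∀ i, 1 - t i ≠ 0 := fun i => (sub_pos.2 (h1 i)).ne'
  have htij : ∀ i j : Fin k, i < j → t i - t j ≠ 0 := fun i j hij => (sub_pos.2 (hanti hij)).ne'
  -- `x ^ n = x ^ n⁺ / x ^ n⁻` off zero (cf. `SymplecticScissors.LogPolytope.mpm_zpow_eq_div`)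
  have zpow_eq_pow_div_pow : ∀ (x : ℝ), x ≠ 0 → ∀ n : ℤ, x ^ n = x ^ n.toNat / x ^ (-n).toNat :=
    fun x hx n => by rw [← zpow_natCast, ← zpow_natCast, ← zpow_sub₀ hx, Int.toNat_sub_toNat_neg]
  -- numerator
  have hnum : MvPolynomial.aeval t (MvPolynomial.C q * ((∏ i : Fin k, MvPolynomial.X i ^ (β i).toNat) * (∏ i : Fin k, (1 - MvPolynomial.X i) ^ (γ i).toNat) * ∏ i : Fin k, ∏ j : Fin k, if i < j then (MvPolynomial.X i - MvPolynomial.X j) ^ (α i j).toNat else 1) : MvPolynomial (Fin k) ℚ)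
      = (q : ℝ) * ((∏ i : Fin k, t i ^ (β i).toNat) * (∏ i : Fin k, (1 - t i) ^ (γ i).toNat) * ∏ i : Fin k, ∏ j : Fin k, if i < j then (t i - t j) ^ (α i j).toNat else 1) := by
    simp only [map_mul, map_prod, map_pow, map_sub, map_one, MvPolynomial.aeval_C, MvPolynomial.aeval_X, eq_ratCast]
    congr 2
    refine Finset.prod_congr rfl fun i _ => Finset.prod_congr rfl fun j _ => ?_
    split_ifs <;> simp [map_pow, map_sub]
  rw [hnum]
  -- split every zpow
  have e1 : (∏ i : Fin k, t i ^ β i) = (∏ i : Fin k, t i ^ (β i).toNat) / ∏ i : Fin k, t i ^ (-β i).toNat := by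
    rw [← Finset.prod_div_distrib]
    exact Finset.prod_congr rfl fun i _ => zpow_eq_pow_div_pow _ (ht0 i) _
  have e2 : (∏ i : Fin k, (1 - t i) ^ γ i) = (∏ i : Fin k, (1 - t i) ^ (γ i).toNat) / ∏ i : Fin k, (1 - t i) ^ (-γ i).toNat := by
    rw [← Finset.prod_div_distrib]
    exact Finset.prod_congr rfl fun i _ => zpow_eq_pow_div_pow _ (ht1 i) _
  have e3 : (∏ i : Fin k, ∏ j : Fin k, if i < j then (t i - t j) ^ α i j else (1:ℝ)) = (∏ i : Fin k, ∏ j : Fin k, if i < j then (t i - t j) ^ (α i j).toNat else (1:ℝ)) / ∏ i : Fin k, ∏ j : Fin k, if i < j then (t i - t j) ^ (-α i j).toNat else (1:ℝ) := by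
    rw [← Finset.prod_div_distrib]
    refine Finset.prod_congr rfl fun i _ => ?_
    rw [← Finset.prod_div_distrib]
    refine Finset.prod_congr rfl fun j _ => ?_
    split_ifs with hij
    · exact zpow_eq_pow_div_pow _ (htij i j hij) _
    · simp
  rw [e1, e2, e3]
  have hB : (∏ i : Fin k, t i ^ (-β i).toNat) ≠ 0 := Finset.prod_ne_zero_iff.2 fun i _ => pow_ne_zero _ (ht0 i)
  have hC : (∏ i : Fin k, (1 - t i) ^ (-γ i).toNat) ≠ 0 := Finset.prod_ne_zero_iff.2 fun i _ => pow_ne_zero _ (ht1 i)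
  have hA : (∏ i : Fin k, ∏ j : Fin k, if i < j then (t i - t j) ^ (-α i j).toNat else (1:ℝ)) ≠ 0 := by
    refine Finset.prod_ne_zero_iff.2 fun i _ => Finset.prod_ne_zero_iff.2 fun j _ => ?_
    split_ifs with hij
    · exact pow_ne_zero _ (htij i j hij)
    · exact one_ne_zero
  field_simp

/-- A convergent simplicial Laurent monomial representation is congruent to a combination of cubical
atoms (`stub_atomReduction`, landed, applied to the genus-zero rewriting `smono_eq_gz`). -/
theorem smono_to_atoms (k : ℕ) (q : ℚ) (β γ : Fin k → ℤ) (α : Fin k → Fin k → ℤ)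
    (s : KZ.IntegralRep k) (hdom : s.domain = {t : Fin k → ℝ | (∀ i, 0 < t i) ∧ (∀ i, t i < 1) ∧ StrictAnti t})
    (hint : EqOn s.integrand (fun t => (q : ℝ) * ((∏ i : Fin k, t i ^ β i) * (∏ i : Fin k, (1 - t i) ^ γ i) * ∏ i : Fin k, ∏ j : Fin k, if i < j then (t i - t j) ^ α i j else 1)) s.domain) :
    ∃ m ∈ AddSubgroup.closure ATOMS⟪k⟫, KZ.of s - m ∈ KZ.relations := by
  refine stub_atomReduction k s
    (MvPolynomial.C q * ((∏ i : Fin k, MvPolynomial.X i ^ (β i).toNat) * (∏ i : Fin k, (1 - MvPolynomial.X i) ^ (γ i).toNat) * ∏ i : Fin k, ∏ j : Fin k, if i < j then (MvPolynomial.X i - MvPolynomial.X j) ^ (α i j).toNat else 1))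
    (fun i j => (-α i j).toNat) (fun i => (-β i).toNat) (fun i => (-γ i).toNat) hdom ?_
  intro t ht
  rw [hint ht]
  exact smono_eq_gz q β γ α t (hdom ▸ ht)

/-! ### The induction over the dimension, in simplicial language -/

/-- Every convergent simplicial Laurent monomial representation reduces to words, given the two
residual statements: strong induction on the dimension.  `k ≤ 3`: through cubical atoms
(`smono_to_atoms`) and the landed chain `DimLeThree.atom_red_le_three`; `k ≥ 4`: `DERHAM_HIGH`, then
`LOGCORE_HIGH` on the log window, products through `stub_simplexProductSplit` + `stub_productClosure`,
lower dimensions through the induction hypothesis. -/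
theorem smono_red (hF : DERHAM_HIGH) (hC : LOGCORE_HIGH) : ∀ k : ℕ, RED⟪SMONO⟪k⟫, WORDS⟫ := by
  intro k
  induction k using Nat.strong_induction_on with
  | _ k IH =>
    rintro z ⟨q, β, γ, α, s, hdom, hint, rfl⟩
    by_cases hk : k ≤ 3
    · obtain ⟨m, hm, hsm⟩ := smono_to_atoms k q β γ α s hdom hint
      exact red_of_sub_mem hsm (closure_transfer (atom_red_le_three k hk) m hm)
    · obtain ⟨m, hm, hsm⟩ := hF k q β γ α s (by omega) hdom hint
      have hW : RED⟪WORDS, WORDS⟫ := fun x hxw =>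
        ⟨x, AddSubgroup.subset_closure hxw, by simp [KZ.relations.zero_mem]⟩
      have hLT : RED⟪SMONOLT⟪k⟫, WORDS⟫ := by
        rintro x ⟨d, hd, hx⟩
        exact IH d hd x hx
      have hP : RED⟪SPROD⟪k⟫, WORDS⟫ := by
        rintro x ⟨q', β', γ', α', s', ⟨p, hp0, hpk, hγ, hα⟩, hdom', hint', rfl⟩
        obtain ⟨d₁, d₂, s₁, s₂, hd₁, hd₂, h₁, h₂, hrel⟩ :=
          stub_simplexProductSplit k p q' β' γ' α' s' hp0 hpk hdom' hint' hγ hα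
        have m₁ := (OfUnnestingNonProduct.red_iff_mem_sup).mp (IH d₁ hd₁ _ h₁)
        have m₂ := (OfUnnestingNonProduct.red_iff_mem_sup).mp (IH d₂ hd₂ _ h₂)
        have hprod := stub_productClosure d₁ d₂ s₁ s₂ m₁ m₂
        rw [← KZ.of_mul_of] at hprod
        exact red_of_sub_mem hrel ((OfUnnestingNonProduct.red_iff_mem_sup).mpr hprod)
      have hLog : RED⟪SLOG⟪k⟫, WORDS⟫ := by
        rintro x ⟨q', β', γ', α', s', ⟨hβ, hγ, hα, hsumk⟩, hdom', hint', rfl⟩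
        obtain ⟨m', hm', hsm'⟩ := hC k q' β' γ' α' s' (by omega) hβ hγ hα hsumk hdom' hint'
        exact red_of_sub_mem hsm' (closure_transfer (red_union (red_union hW hP) hLT) m' hm')
      exact red_of_sub_mem hsm (closure_transfer (red_union (red_union hLog hP) hLT) m hm)

/-- Every cubical atom reduces to words, given the two residual statements: `stub_chartBack` +
`smono_red`. -/
theorem atom_red (hF : DERHAM_HIGH) (hC : LOGCORE_HIGH) (k : ℕ) : RED⟪ATOMS⟪k⟫, WORDS⟫ := by
  rintro z ⟨q, a, e, s, hdom, hint, rfl⟩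
  obtain ⟨q', β, γ, α, s', hdom', hint', hrel⟩ := stub_chartBack k q a e s hdom hint
  exact red_of_sub_mem hrel (smono_red hF hC k _ ⟨q', β, γ, α, s', hdom', hint', rfl⟩)

end OfSimplicialResidual

/-- **`DihedralNormalForm` from the simplicial residual** (the conditional closing theorem of
skeleton v7 of the line `torus-descent-sum-shadow`).  If (F) every convergent simplicial Laurent
monomial representation of dimension `k ≥ 4` is congruent modulo `KZ.relations` to a
`ℤ`-combination of log-window representations, simplicial product monomials of dimension `k` and
convergent simplicial monomials of dimension `< k`, and (C) every log-window representation of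
dimension `k ≥ 4` is congruent modulo `KZ.relations` to a `ℤ`-combination of MZV word
representations, simplicial product monomials of dimension `k` and convergent simplicial monomials of
dimension `< k` (both verbatim), then `LinRedNormalForm.DihedralNormalForm` holds: every absolutely
convergent genus-zero representation on an open ordered simplex is congruent modulo `KZ.relations` to
a `ℤ`-combination of MZV word representations.  Proof: `stub_atomReduction`, then
`OfSimplicialResidual.atom_red`, extended additively by `DimLeThree.closure_transfer`.
[cite: KontsevichZagier2001, §1.2] [cite: BrownENS2009, Thm 1.1] -/
theorem dihedralNormalForm_of_simplicialResidual : (∀ (k : ℕ) (q : ℚ) (β γ : Fin k → ℤ) (α : Fin k → Fin k → ℤ) (s : Literature.NumberTheory.Transcendental.KZ.IntegralRep k), 4 ≤ k → s.domain = {t : Fin k → ℝ | (∀ i, 0 < t i) ∧ (∀ i, t i < 1) ∧ StrictAnti t} → Set.EqOn s.integrand (fun t => (q : ℝ) * ((∏ i : Fin k, t i ^ β i) * (∏ i : Fin k, (1 - t i) ^ γ i) * ∏ i : Fin k, ∏ j : Fin k, if i < j then (t i - t j) ^ α i j else 1)) s.domain → ∃ m ∈ AddSubgroup.closure ({z : Literature.NumberTheory.Transcendental.KZ.FormalRep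 | ∃ (q : ℚ) (β γ : Fin k → ℤ) (α : Fin k → Fin k → ℤ) (s : Literature.NumberTheory.Transcendental.KZ.IntegralRep k), ((∀ i : Fin k, β i = 0 ∨ β i = -1) ∧ (∀ i : Fin k, γ i = 0 ∨ γ i = -1) ∧ (∀ i j : Fin k, α i j = 0 ∨ α i j = -1) ∧ (∑ i : Fin k, β i) + (∑ i : Fin k, γ i) + (∑ i : Fin k, ∑ j : Fin k, if i < j then α i j else 0) = -(k : ℤ)) ∧ s.domain = {t : Fin k → ℝ | (∀ i, 0 < t i) ∧ (∀ i, t i < 1) ∧ StrictAnti t} ∧ Set.EqOn s.integrand (fun t => (q : ℝ) * ((∏ i : Fin k, t i ^ β i) * (∏ i : Fin k, (1 - t i) ^ γ i) * ∏ i : Fin k, ∏ j : Fin k, if i < j then (t i - t j) ^ α i j else 1)) s.domain ∧ z = Literature.NumberTheory.Transcendental.KZ.of s} ∪ {z : Literature.NumberTheory.Transcendental.KZ.FormalRep | ∃ (q : ℚ) (β γ : Fin k → ℤ) (α : Fin k → Fin k → ℤ) (s : Literature.NumberTheory.Transcendental.KZ.IntegralRep k), (∃ p : ℕ, 0 < p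 ∧ p < k ∧ (∀ i : Fin k, p ≤ (i : ℕ) → γ i = 0) ∧ (∀ i j : Fin k, (i : ℕ) + 1 < p → p ≤ (j : ℕ) → α i j = 0)) ∧ s.domain = {t : Fin k → ℝ | (∀ i, 0 < t i) ∧ (∀ i, t i < 1) ∧ StrictAnti t} ∧ Set.EqOn s.integrand (fun t => (q : ℝ) * ((∏ i : Fin k, t i ^ β i) * (∏ i : Fin k, (1 - t i) ^ γ i) * ∏ i : Fin k, ∏ j : Fin k, if i < j then (t i - t j) ^ α i j else 1)) s.domain ∧ z = Literature.NumberTheory.Transcendental.KZ.of s} ∪ {z : Literature.NumberTheory.Transcendental.KZ.FormalRep | ∃ d : ℕ, d < k ∧ z ∈ {z : Literature.NumberTheory.Transcendental.KZ.FormalRep | ∃ (q : ℚ) (β γ : Fin d → ℤ) (α : Fin d → Fin d → ℤ) (s : Literature.NumberTheory.Transcendental.KZ.IntegralRep d), s.domain = {t : Fin d → ℝ | (∀ i, 0 < t i) ∧ (∀ i, t i < 1) ∧ StrictAnti t} ∧ Set.EqOn s.integrand (fun t => (q : ℝ) * ((∏ i : Fin d, t i ^ β i) * (∏ i : Fin d,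 (1 - t i) ^ γ i) * ∏ i : Fin d, ∏ j : Fin d, if i < j then (t i - t j) ^ α i j else 1)) s.domain ∧ z = Literature.NumberTheory.Transcendental.KZ.of s}}), Literature.NumberTheory.Transcendental.KZ.of s - m ∈ Literature.NumberTheory.Transcendental.KZ.relations) → (∀ (k : ℕ) (q : ℚ) (β γ : Fin k → ℤ) (α : Fin k → Fin k → ℤ) (s : Literature.NumberTheory.Transcendental.KZ.IntegralRep k), 4 ≤ k → (∀ i : Fin k, β i = 0 ∨ β i = -1) → (∀ i : Fin k, γ i = 0 ∨ γ i = -1) → (∀ i j : Fin k, α i j = 0 ∨ α i j = -1) → (∑ i : Fin k, β i) + (∑ i : Fin k, γ i) + (∑ i : Fin k, ∑ j : Fin k, if i < j then α i j else 0) = -(k : ℤ) → s.domain = {t : Fin k → ℝ | (∀ i, 0 < t i) ∧ (∀ i, t i < 1) ∧ StrictAnti t} → Set.EqOn s.integrand (fun t => (q : ℝ) * ((∏ i : Fin k, t i ^ β i) * (∏ i : Fin k, (1 - t i) ^ γ i) * ∏ i : Fin k, ∏ j : Fin k, if i < j then (t i - t j) ^ α i j else 1)) s.domain → ∃ m ∈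 AddSubgroup.closure ({x : Literature.NumberTheory.Transcendental.KZ.FormalRep | ∃ (w : ℕ) (ε : Fin w → Bool) (q : ℚ) (s : Literature.NumberTheory.Transcendental.KZ.IntegralRep w), s.domain = {t | (∀ i, 0 < t i) ∧ (∀ i, t i < 1) ∧ StrictAnti t} ∧ Set.EqOn s.integrand (fun t => (q : ℝ) * ∏ i, if ε i then 1 / (1 - t i) else 1 / t i) s.domain ∧ x = Literature.NumberTheory.Transcendental.KZ.of s} ∪ {z : Literature.NumberTheory.Transcendental.KZ.FormalRep | ∃ (q : ℚ) (β γ : Fin k → ℤ) (α : Fin k → Fin k → ℤ) (s : Literature.NumberTheory.Transcendental.KZ.IntegralRep k), (∃ p : ℕ, 0 < p ∧ p < k ∧ (∀ i : Fin k, p ≤ (i : ℕ) → γ i = 0) ∧ (∀ i j : Fin k, (i : ℕ) + 1 < p → p ≤ (j : ℕ) → α i j = 0)) ∧ s.domain = {t : Fin k → ℝ | (∀ i, 0 < t i) ∧ (∀ i, t i < 1) ∧ StrictAnti t} ∧ Set.EqOn s.integrand (fun t => (q : ℝ) * ((∏ i : Fin k, t i ^ β i) * (∏ i : Fin k, (1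 - t i) ^ γ i) * ∏ i : Fin k, ∏ j : Fin k, if i < j then (t i - t j) ^ α i j else 1)) s.domain ∧ z = Literature.NumberTheory.Transcendental.KZ.of s} ∪ {z : Literature.NumberTheory.Transcendental.KZ.FormalRep | ∃ d : ℕ, d < k ∧ z ∈ {z : Literature.NumberTheory.Transcendental.KZ.FormalRep | ∃ (q : ℚ) (β γ : Fin d → ℤ) (α : Fin d → Fin d → ℤ) (s : Literature.NumberTheory.Transcendental.KZ.IntegralRep d), s.domain = {t : Fin d → ℝ | (∀ i, 0 < t i) ∧ (∀ i, t i < 1) ∧ StrictAnti t} ∧ Set.EqOn s.integrand (fun t => (q : ℝ) * ((∏ i : Fin d, t i ^ β i) * (∏ i : Fin d, (1 - t i) ^ γ i) * ∏ i : Fin d, ∏ j : Fin d, if i < j then (t i - t j) ^ α i j else 1)) s.domain ∧ z = Literature.NumberTheory.Transcendental.KZ.of s}}), Literature.NumberTheory.Transcendental.KZ.of s - m ∈ Literature.NumberTheory.Transcendental.KZ.relations) → Summit.KontsevichZagierPeriods.KontsevichZagierPeriods.Theses.LinRedNormalForm.DihedralNormalForm := by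
  intro hF hC k r p a b c hdom hint
  obtain ⟨m, hm, hrm⟩ := stub_atomReduction k r p a b c hdom hint
  exact DimLeThree.red_of_sub_mem hrm
    (DimLeThree.closure_transfer (OfSimplicialResidual.atom_red hF hC k) m hm)

/-- **`DihedralNormalForm` from the registered stubs** `stub_deRham : D → (F)` and
`stub_logCore : D → (C)` of skeleton v7 (verbatim shapes), `D` being the statement of the landed
dilation move `stub_dilationNL`, which discharges the antecedent.
[cite: KontsevichZagier2001, §1.2] -/
theorem dihedralNormalForm_of_registeredStubs : ((∀ (k : ℕ) (m : Fin (k + 1)) (q : ℚ) (β γ : Fin (k + 1) → ℤ) (α : Fin (k + 1) → Fin (k + 1) → ℤ) (R : Literature.NumberTheory.Transcendental.KZ.IntegralRep (k + 1)) (rb : Literature.NumberTheory.Transcendental.KZ.IntegralRep k), R.domain = {t : Fin (k + 1) → ℝ | (∀ i, 0 < t i) ∧ (∀ i, t i < 1) ∧ StrictAnti t} → Set.EqOn R.integrand (fun t => ((q : ℝ) * ((∏ i : Fin (k + 1), t i ^ β i) * (∏ i : Fin (k + 1), (1 - t i) ^ γ i) * ∏ i : Fin (k + 1), ∏ j : Fin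 (k + 1), if i < j then (t i - t j) ^ α i j else 1)) * ((((k : ℝ) + 1 - (m : ℝ)) + (∑ j : Fin (k + 1), if m ≤ j then (β j : ℝ) else 0) + (∑ i : Fin (k + 1), ∑ j : Fin (k + 1), if m ≤ i ∧ i < j then (α i j : ℝ) else 0)) + (∑ i : Fin (k + 1), ∑ j : Fin (k + 1), if i < m ∧ m ≤ j then (α i j : ℝ) * (-t j) / (t i - t j) else 0) + (∑ j : Fin (k + 1), if m ≤ j then (γ j : ℝ) * (-t j) / (1 - t j) else 0))) R.domain → rb.domain = {t : Fin k → ℝ | (∀ i, 0 < t i) ∧ (∀ i, t i < 1) ∧ StrictAnti t} → Set.EqOn rb.integrand (fun y => (if h : 0 < (m : ℕ) then y ⟨(m : ℕ) - 1, by omega⟩ else 1) * ((q : ℝ) * ((∏ i : Fin (k + 1), (Fin.insertNth m (if h : 0 < (m : ℕ) then y ⟨(m : ℕ) - 1, by omega⟩ else 1) y : Fin (k + 1) → ℝ) i ^ β i) * (∏ i : Fin (k + 1), (1 - (Fin.insertNth m (if h : 0 < (m : ℕ) then y ⟨(m : ℕ) - 1, by omega⟩ else 1) y : Fin (k + 1)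 → ℝ) i) ^ γ i) * ∏ i : Fin (k + 1), ∏ j : Fin (k + 1), if i < j then ((Fin.insertNth m (if h : 0 < (m : ℕ) then y ⟨(m : ℕ) - 1, by omega⟩ else 1) y : Fin (k + 1) → ℝ) i - (Fin.insertNth m (if h : 0 < (m : ℕ) then y ⟨(m : ℕ) - 1, by omega⟩ else 1) y : Fin (k + 1) → ℝ) j) ^ α i j else 1))) rb.domain → (if h : 0 < (m : ℕ) then 0 ≤ α ⟨(m : ℕ) - 1, by omega⟩ m else 0 ≤ γ m) → 0 < ((k : ℤ) + 1 - (m : ℤ)) + (∑ j : Fin (k + 1), if m ≤ j then β j else 0) + (∑ i : Fin (k + 1), ∑ j : Fin (k + 1), if m ≤ i ∧ i < j then α i j else 0) → Literature.NumberTheory.Transcendental.KZ.of R - Literature.NumberTheory.Transcendental.KZ.of rb ∈ Literature.NumberTheory.Transcendental.KZ.relations) → ∀ (k : ℕ) (q : ℚ) (β γ : Fin k → ℤ) (α : Fin k → Fin k → ℤ) (s : Literature.NumberTheory.Transcendental.KZ.IntegralRep k), 4 ≤ k → s.domain = {t : Fin k → ℝ | (∀ i, 0 < t i) ∧ (∀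 i, t i < 1) ∧ StrictAnti t} → Set.EqOn s.integrand (fun t => (q : ℝ) * ((∏ i : Fin k, t i ^ β i) * (∏ i : Fin k, (1 - t i) ^ γ i) * ∏ i : Fin k, ∏ j : Fin k, if i < j then (t i - t j) ^ α i j else 1)) s.domain → ∃ m ∈ AddSubgroup.closure ({z : Literature.NumberTheory.Transcendental.KZ.FormalRep | ∃ (q : ℚ) (β γ : Fin k → ℤ) (α : Fin k → Fin k → ℤ) (s : Literature.NumberTheory.Transcendental.KZ.IntegralRep k), ((∀ i : Fin k, β i = 0 ∨ β i = -1) ∧ (∀ i : Fin k, γ i = 0 ∨ γ i = -1) ∧ (∀ i j : Fin k, α i j = 0 ∨ α i j = -1) ∧ (∑ i : Fin k, β i) + (∑ i : Fin k, γ i) + (∑ i : Fin k, ∑ j : Fin k, if i < j then α i j else 0) = -(k : ℤ)) ∧ s.domain = {t : Fin k → ℝ | (∀ i, 0 < t i) ∧ (∀ i, t i < 1) ∧ StrictAnti t} ∧ Set.EqOn s.integrand (fun t => (q : ℝ) * ((∏ i : Fin k, t i ^ β i) * (∏ i : Fin k, (1 - t i) ^ γ i) * ∏ i : Fin k, ∏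 j : Fin k, if i < j then (t i - t j) ^ α i j else 1)) s.domain ∧ z = Literature.NumberTheory.Transcendental.KZ.of s} ∪ {z : Literature.NumberTheory.Transcendental.KZ.FormalRep | ∃ (q : ℚ) (β γ : Fin k → ℤ) (α : Fin k → Fin k → ℤ) (s : Literature.NumberTheory.Transcendental.KZ.IntegralRep k), (∃ p : ℕ, 0 < p ∧ p < k ∧ (∀ i : Fin k, p ≤ (i : ℕ) → γ i = 0) ∧ (∀ i j : Fin k, (i : ℕ) + 1 < p → p ≤ (j : ℕ) → α i j = 0)) ∧ s.domain = {t : Fin k → ℝ | (∀ i, 0 < t i) ∧ (∀ i, t i < 1) ∧ StrictAnti t} ∧ Set.EqOn s.integrand (fun t => (q : ℝ) * ((∏ i : Fin k, t i ^ β i) * (∏ i : Fin k, (1 - t i) ^ γ i) * ∏ i : Fin k, ∏ j : Fin k, if i < j then (t i - t j) ^ α i j else 1)) s.domain ∧ z = Literature.NumberTheory.Transcendental.KZ.of s} ∪ {z : Literature.NumberTheory.Transcendental.KZ.FormalRep | ∃ d : ℕ, d < k ∧ z ∈ {z : Literature.NumberTheory.Transcendental.KZ.FormalRep | ∃ (q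 : ℚ) (β γ : Fin d → ℤ) (α : Fin d → Fin d → ℤ) (s : Literature.NumberTheory.Transcendental.KZ.IntegralRep d), s.domain = {t : Fin d → ℝ | (∀ i, 0 < t i) ∧ (∀ i, t i < 1) ∧ StrictAnti t} ∧ Set.EqOn s.integrand (fun t => (q : ℝ) * ((∏ i : Fin d, t i ^ β i) * (∏ i : Fin d, (1 - t i) ^ γ i) * ∏ i : Fin d, ∏ j : Fin d, if i < j then (t i - t j) ^ α i j else 1)) s.domain ∧ z = Literature.NumberTheory.Transcendental.KZ.of s}}), Literature.NumberTheory.Transcendental.KZ.of s - m ∈ Literature.NumberTheory.Transcendental.KZ.relations) → ((∀ (k : ℕ) (m : Fin (k + 1)) (q : ℚ) (β γ : Fin (k + 1) → ℤ) (α : Fin (k + 1) → Fin (k + 1) → ℤ) (R : Literature.NumberTheory.Transcendental.KZ.IntegralRep (k + 1)) (rb : Literature.NumberTheory.Transcendental.KZ.IntegralRep k), R.domain = {t : Fin (k + 1) → ℝ | (∀ i, 0 < t i) ∧ (∀ i, t i < 1) ∧ StrictAnti t} → Set.EqOn R.integrand (fun t => ((q : ℝ) * ((∏ i : Fin (k +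 1), t i ^ β i) * (∏ i : Fin (k + 1), (1 - t i) ^ γ i) * ∏ i : Fin (k + 1), ∏ j : Fin (k + 1), if i < j then (t i - t j) ^ α i j else 1)) * ((((k : ℝ) + 1 - (m : ℝ)) + (∑ j : Fin (k + 1), if m ≤ j then (β j : ℝ) else 0) + (∑ i : Fin (k + 1), ∑ j : Fin (k + 1), if m ≤ i ∧ i < j then (α i j : ℝ) else 0)) + (∑ i : Fin (k + 1), ∑ j : Fin (k + 1), if i < m ∧ m ≤ j then (α i j : ℝ) * (-t j) / (t i - t j) else 0) + (∑ j : Fin (k + 1), if m ≤ j then (γ j : ℝ) * (-t j) / (1 - t j) else 0))) R.domain → rb.domain = {t : Fin k → ℝ | (∀ i, 0 < t i) ∧ (∀ i, t i < 1) ∧ StrictAnti t} → Set.EqOn rb.integrand (fun y => (if h : 0 < (m : ℕ) then y ⟨(m : ℕ) - 1, by omega⟩ else 1) * ((q : ℝ) * ((∏ i : Fin (k + 1), (Fin.insertNth m (if h : 0 < (m : ℕ) then y ⟨(m : ℕ) - 1, by omega⟩ else 1) y : Fin (k + 1) → ℝ) i ^ β i) * (∏ i : Fin (k + 1), (1 -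 (Fin.insertNth m (if h : 0 < (m : ℕ) then y ⟨(m : ℕ) - 1, by omega⟩ else 1) y : Fin (k + 1) → ℝ) i) ^ γ i) * ∏ i : Fin (k + 1), ∏ j : Fin (k + 1), if i < j then ((Fin.insertNth m (if h : 0 < (m : ℕ) then y ⟨(m : ℕ) - 1, by omega⟩ else 1) y : Fin (k + 1) → ℝ) i - (Fin.insertNth m (if h : 0 < (m : ℕ) then y ⟨(m : ℕ) - 1, by omega⟩ else 1) y : Fin (k + 1) → ℝ) j) ^ α i j else 1))) rb.domain → (if h : 0 < (m : ℕ) then 0 ≤ α ⟨(m : ℕ) - 1, by omega⟩ m else 0 ≤ γ m) → 0 < ((k : ℤ) + 1 - (m : ℤ)) + (∑ j : Fin (k + 1), if m ≤ j then β j else 0) + (∑ i : Fin (k + 1), ∑ j : Fin (k + 1), if m ≤ i ∧ i < j then α i j else 0) → Literature.NumberTheory.Transcendental.KZ.of R - Literature.NumberTheory.Transcendental.KZ.of rb ∈ Literature.NumberTheory.Transcendental.KZ.relations) → ∀ (k : ℕ) (q : ℚ) (β γ : Fin k → ℤ) (α : Fin k → Fin k → ℤ) (s : Literature.NumberTheory.Transcendental.KZ.IntegralRep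 k), 4 ≤ k → (∀ i : Fin k, β i = 0 ∨ β i = -1) → (∀ i : Fin k, γ i = 0 ∨ γ i = -1) → (∀ i j : Fin k, α i j = 0 ∨ α i j = -1) → (∑ i : Fin k, β i) + (∑ i : Fin k, γ i) + (∑ i : Fin k, ∑ j : Fin k, if i < j then α i j else 0) = -(k : ℤ) → s.domain = {t : Fin k → ℝ | (∀ i, 0 < t i) ∧ (∀ i, t i < 1) ∧ StrictAnti t} → Set.EqOn s.integrand (fun t => (q : ℝ) * ((∏ i : Fin k, t i ^ β i) * (∏ i : Fin k, (1 - t i) ^ γ i) * ∏ i : Fin k, ∏ j : Fin k, if i < j then (t i - t j) ^ α i j else 1)) s.domain → ∃ m ∈ AddSubgroup.closure ({x : Literature.NumberTheory.Transcendental.KZ.FormalRep | ∃ (w : ℕ) (ε : Fin w → Bool) (q : ℚ) (s : Literature.NumberTheory.Transcendental.KZ.IntegralRep w), s.domain = {t | (∀ i, 0 < t i) ∧ (∀ i, t i < 1) ∧ StrictAnti t} ∧ Set.EqOn s.integrand (fun t => (q : ℝ) * ∏ i, if ε i then 1 / (1 - t i) else 1 / t i) s.domain ∧ x = Literature.NumberTheory.Transcendental.KZ.of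 s} ∪ {z : Literature.NumberTheory.Transcendental.KZ.FormalRep | ∃ (q : ℚ) (β γ : Fin k → ℤ) (α : Fin k → Fin k → ℤ) (s : Literature.NumberTheory.Transcendental.KZ.IntegralRep k), (∃ p : ℕ, 0 < p ∧ p < k ∧ (∀ i : Fin k, p ≤ (i : ℕ) → γ i = 0) ∧ (∀ i j : Fin k, (i : ℕ) + 1 < p → p ≤ (j : ℕ) → α i j = 0)) ∧ s.domain = {t : Fin k → ℝ | (∀ i, 0 < t i) ∧ (∀ i, t i < 1) ∧ StrictAnti t} ∧ Set.EqOn s.integrand (fun t => (q : ℝ) * ((∏ i : Fin k, t i ^ β i) * (∏ i : Fin k, (1 - t i) ^ γ i) * ∏ i : Fin k, ∏ j : Fin k, if i < j then (t i - t j) ^ α i j else 1)) s.domain ∧ z = Literature.NumberTheory.Transcendental.KZ.of s} ∪ {z : Literature.NumberTheory.Transcendental.KZ.FormalRep | ∃ d : ℕ, d < k ∧ z ∈ {z : Literature.NumberTheory.Transcendental.KZ.FormalRep | ∃ (q : ℚ) (β γ : Fin d → ℤ) (α : Fin d → Fin d → ℤ) (s : Literature.NumberTheory.Transcendental.KZ.IntegralRep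 d), s.domain = {t : Fin d → ℝ | (∀ i, 0 < t i) ∧ (∀ i, t i < 1) ∧ StrictAnti t} ∧ Set.EqOn s.integrand (fun t => (q : ℝ) * ((∏ i : Fin d, t i ^ β i) * (∏ i : Fin d, (1 - t i) ^ γ i) * ∏ i : Fin d, ∏ j : Fin d, if i < j then (t i - t j) ^ α i j else 1)) s.domain ∧ z = Literature.NumberTheory.Transcendental.KZ.of s}}), Literature.NumberTheory.Transcendental.KZ.of s - m ∈ Literature.NumberTheory.Transcendental.KZ.relations) → Summit.KontsevichZagierPeriods.KontsevichZagierPeriods.Theses.LinRedNormalForm.DihedralNormalForm :=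
  fun hF hC => dihedralNormalForm_of_simplicialResidual (hF stub_dilationNL) (hC stub_dilationNL)

end Summit.KontsevichZagierPeriods.DihedralNormalForm.TorusDescent
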